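import Literature.NumberTheory.EllipticCurves.BinaryQuarticCovariants
import Literature.NumberTheory.EllipticCurves.BhargavaShankarLocalMasses
import Mathlib.AlgebraicGeometry.EllipticCurve.Affine.Point
import HarnessLib

/-!
# Bhargava–Shankar, Lemma 5.10 (field-level parametrization), first half: the `2`-covering map
# `C_f → E_{I,J}` and the normal forms `f_P`, `f_O` of `K`-soluble quartics with invariants `I`, `J`

Topic `Literature/NumberTheory/EllipticCurves`; companion of `BinaryQuarticForms.lean`,
`BinaryQuarticStabilizer.lean` (twisted action `BinaryQuartic.twist`, Lemma 5.11) and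
`BinaryQuarticCovariants.lean` (`g₄`, `g₆`, the syzygy), `BhargavaShankarLocalMasses.lean`
(`curveOfInvariants K I J = E_{I,J} : y² = x³ − (I/3)x − J/27`).

Source: M. Bhargava, A. Shankar, *Binary quartic forms having bounded invariants, and the
boundedness of the average rank of elliptic curves*, Ann. of Math. (2) 181 (2015) 191–242, §5.2 of
the held arXiv text `arXiv:1006.1002v2` (= §3.1–3.2, Thm 3.2 of the published version):

> **Lemma 5.10.** Let `E` be an elliptic curve over a field `K` having invariants `I ≠ 0` and
> `J ≠ 0`. Then there exists a natural map `Q_E : E(K)/2E(K) → {K-equivalence classes of quartics}`.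
> This map is injective and the image consists exactly of the `K`-soluble `K`-equivalence classes
> of quartics having invariants equal to `I` and `J`. ("See, e.g., [CS] for an explicit
> construction of `Q_E` when `K` has characteristic not `2` or `3`.")

Here `E = E_{I,J}`, a form `f ∈ V_K` is *`K`-soluble* if `z² = f(x,y)` has a solution with
`(x,y) ≠ (0,0)` (`BinaryQuartic.IsSoluble`), and for forms with the same invariants
`K`-equivalence is `PGL₂(K)`-equivalence for the twisted action (`BinaryQuartic.PGL2Equiv`,
`BinaryQuartic.twist`; proof of Thm 5.6). This file makes the construction explicit and proves the
half of Lemma 5.10 saying that **every `K`-soluble class with invariants `(I, J)` is the class of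
one of the explicit forms `f_O`, `f_P` (`P ∈ E_{I,J}(K)`)**, over any field of characteristic `0`:

* `BinaryQuartic.coveringX f x y z = g₄(x,y)/(12 z²)`, `BinaryQuartic.coveringY f x y z = g₆(x,y)/(8 z³)`:
  **the `2`-covering map** `C_f : z² = f(x,y) ⟶ E_{I(f),J(f)}` (Cremona 2001, Prop. 4.2: the map
  `(x:y:z) ↦ (6yz g₄ : 27 g₆ : (2yz)³)` to `Y² = X³ − 27IX − 27J`, rescaled by `(X,Y) = (9x, 27y)`
  to `E_{I,J}`); it lands on `E_{I,J}` by the syzygy (`equation_covering`), and it is **invariant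
  under the twisted action** (`coveringX_twist`, `coveringY_twist`: `γ` carries the point
  `(x, y, z)` of `C_f` to the point `((x,y)γ⁻¹, z/det γ)` of `C_{γ·f}` with the same image) and
  under rescaling of `(x, y, z) ↦ (tx, ty, t²z)`.
* `BinaryQuartic.quarticOfPoint I ξ η = f_P = x⁴ − (3ξ/2)x²y² + η xy³ + (I/12 − 3ξ²/16)y⁴` for
  `P = (ξ, η)`: it has invariants `I` and `J = −27(η² − ξ³ + (I/3)ξ)`, i.e. `(I, J)` exactly when
  `P ∈ E_{I,J}(K)` (`I_quarticOfPoint`, `J_quarticOfPoint`), it is `K`-soluble (the point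
  `p₀ = (1,0,1)`), and the covering map sends `p₀` to `P` (`coveringX_quarticOfPoint`,
  `coveringY_quarticOfPoint`);
  `BinaryQuartic.trivialQuartic I J = f_O = x³y − (I/3)xy³ − (J/27)y⁴ = y · (x³ − (I/3)xy² − (J/27)y³)`
  ("`y` times the cubic of `E_{I,J}`"): invariants `(I, J)`, `K`-soluble (the point `(1,0,0)`).
* **Normal forms** (`exists_twist_eq_quarticOfPoint`, `exists_twist_eq_trivialQuartic`,
  `pgl2Equiv_normalForm`): if `z² = f(x,y)` with `z ≠ 0` then `f` is `PGL₂(K)`-equivalent to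
  `f_P` with `P` the image of `(x,y,z)` under the covering map (move `[x:y]` to `[1:0]` with
  determinant `z`, making `f` monic, then translate to kill `b`); if `f(x,y) = 0` at
  `(x,y) ≠ (0,0)` and `Δ(f) ≠ 0` then `f` is `PGL₂(K)`-equivalent to `f_O` (move the root to
  `[1:0]`, normalise `b = 1`, translate to kill `c`). Hence every `K`-soluble `f` with `Δ(f) ≠ 0`
  and invariants `(I,J)` is `PGL₂(K)`-equivalent to `f_O` or to `f_P` for a `K`-point `P` of
  `E_{I,J}` — the classes of `f_O` and of the `f_P` exhaust the `K`-soluble classes with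
  invariants `(I, J)`.

What is NOT here (the other half of Lemma 5.10, for a later file): `f_P ∼ f_Q ↔ P − Q ∈ 2E(K)`
and `f_P ∼ f_O ↔ P ∈ 2E(K)`, i.e. that the induced map `E(K)/2E(K) → {classes}` is well defined
and injective (Cremona 2001, Prop. 4.3 (4): the image of `C_f(K)` in `E(K)` is a coset of `2E(K)`).

## References

* M. Bhargava, A. Shankar, Ann. of Math. (2) 181 (2015) 191–242, Lemma 5.10 (arXiv:1006.1002v2
  numbering; Thm 3.2 of the published version). [cite: BhargavaShankarAnnals2015, Lemma 5.10 (arXiv:1006.1002v2 numbering)]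
* J. E. Cremona, *Classical invariants and 2-descent on elliptic curves*, J. Symbolic Comput. 31
  (2001) 71–87, §2 eq. (2.3) (syzygy), Prop. 4.1 (soluble ⇔ equivalent to a form with square
  leading coefficient), Prop. 4.2 (the covering map), Prop. 4.3. [cite: Cremona2001, Prop. 4.2]

## Design

* Points of `C_f : z² = f(x,y)` are handled as triples `(x, y, z)` with `z² = f(x,y)` (weighted
  projective coordinates `(x : y : z) ∼ (tx : ty : t²z)`); no quotient type is introduced.
* The covering map is given by its two affine coordinates (junk value at `z = 0`, where the true
  image is the origin `O` of `E`); `coveringPoint` packages it as a point of Mathlib's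
  `(curveOfInvariants K I J).toAffine.Point` when `z ≠ 0` and `Δ ≠ 0`.
* The field is assumed of characteristic `0` (the cases `K = ℚ`, `ℚ_p`, `ℝ` of the paper; the
  published source states Thm 3.2 for characteristic not `2` or `3`): this keeps the rational
  constants `1/2, 1/3, 1/12, 1/16, 1/27` of the normal forms inside `ring`/`field_simp`.
-/

noncomputable section

open scoped Classical
open Matrix

namespace Literature.NumberTheory.EllipticCurves

namespace BinaryQuartic

variable {K : Type*} [Field K]

/-! ## Coefficients of substituted and twisted forms -/

/-- The leading coefficient of `f ∘ γ` is the value of `f` at the first row of `γ`: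
`(f ∘ γ)(1,0) = f((1,0)γ)`. [folklore] -/
theorem subst_a_eq_eval (f : BinaryQuartic K) (γ : Matrix (Fin 2) (Fin 2) K) :
    (f.subst γ).a = f.eval (γ 0 0) (γ 0 1) := by
  simp only [subst, eval]

/-- The leading coefficient of `γ · f` is `f((1,0)γ)/(det γ)²`. [folklore] -/
theorem twist_a_eq (γ : Matrix (Fin 2) (Fin 2) K) (f : BinaryQuartic K) :
    (twist γ f).a = (γ.det ^ 2)⁻¹ * f.eval (γ 0 0) (γ 0 1) := by
  rw [twist, smul_a, subst_a_eq_eval]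

/-- A lower shear `(1 0; t 1)` (i.e. `x ↦ x + ty`) keeps `a` and adds `4at` to `b`. [folklore] -/
theorem twist_lowerShear (f : BinaryQuartic K) (t : K) :
    twist !![1, 0; t, 1] f =
      ⟨f.a, 4 * f.a * t + f.b, 6 * f.a * t ^ 2 + 3 * f.b * t + f.c,
        4 * f.a * t ^ 3 + 3 * f.b * t ^ 2 + 2 * f.c * t + f.d,
        f.a * t ^ 4 + f.b * t ^ 3 + f.c * t ^ 2 + f.d * t + f.e⟩ := by
  have hdet : (!![1, 0; t, 1] : Matrix (Fin 2) (Fin 2) K).det = 1 := by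
    simp [Matrix.det_fin_two]
  ext <;> simp [twist, hdet, subst]

variable [CharZero K]

/-! ## The `2`-covering map `C_f → E_{I,J}` -/

/-- The `x`-coordinate `g₄(x,y)/(12 z²)` of the image of the point `(x, y, z)` of
`C_f : z² = f(x,y)` under the `2`-covering map `C_f → E_{I,J} : y² = x³ − (I/3)x − J/27`
(Cremona 2001, Prop. 4.2, rescaled from `Y² = X³ − 27IX − 27J` by `X = 9x`; junk at `z = 0`,
where the image is the origin). [cite: Cremona2001, Prop. 4.2] -/
def coveringX (f : BinaryQuartic K) (x y z : K) : K :=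
  (g4 f).eval x y / (12 * z ^ 2)

/-- The `y`-coordinate `g₆(x,y)/(8 z³)` of the image of `(x, y, z) ∈ C_f` under the `2`-covering
map `C_f → E_{I,J}` (Cremona 2001, Prop. 4.2, rescaled by `Y = 27y`; junk at `z = 0`).
[cite: Cremona2001, Prop. 4.2] -/
def coveringY (f : BinaryQuartic K) (x y z : K) : K :=
  f.g6 x y / (8 * z ^ 3)

/-- **The covering map lands on `E_{I,J}`** (Cremona 2001, Prop. 4.2): if `z² = f(x,y)`, `z ≠ 0`,
then `(g₄(x,y)/(12z²), g₆(x,y)/(8z³))` satisfies `y² = x³ − (I/3)x − J/27` — the syzygy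
`27g₆² = g₄³ − 48If²g₄ − 64Jf³` divided by `1728 z⁶`. [cite: Cremona2001, Prop. 4.2] -/
theorem equation_covering (f : BinaryQuartic K) {x y z : K} (hz : z ^ 2 = f.eval x y)
    (hz0 : z ≠ 0) :
    (curveOfInvariants K f.I f.J).toAffine.Equation (coveringX f x y z) (coveringY f x y z) := by
  have hsyz := syzygy f x y
  have hz4 : f.eval x y ^ 2 = z ^ 4 := by rw [← hz]; ring
  have hz6 : f.eval x y ^ 3 = z ^ 6 := by rw [← hz]; ring
  rw [hz4, hz6] at hsyz
  rw [WeierstrassCurve.Affine.equation_iff]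
  simp only [curveOfInvariants, coveringX, coveringY]
  field_simp
  linear_combination 5184 * hsyz

/-- Off the discriminant locus `E_{I,J}` is an elliptic curve: `Δ(E_{I,J}) = 16(4I³ − J²)/27`
(characteristic `0`). [cite: BhargavaShankarAnnals2015, §5 p. 31 (E_{I,J}; arXiv:1006.1002v2 numbering)] -/
theorem isElliptic_curveOfInvariants_of_ne {I J : K} (hΔ : 4 * I ^ 3 - J ^ 2 ≠ 0) :
    (curveOfInvariants K I J).IsElliptic := by
  refine ⟨Ne.isUnit ?_⟩
  have hΔ' : (curveOfInvariants K I J).Δ = 16 * (4 * I ^ 3 - J ^ 2) / 27 := by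
    simp only [curveOfInvariants, WeierstrassCurve.Δ, WeierstrassCurve.b₂, WeierstrassCurve.b₄,
      WeierstrassCurve.b₆, WeierstrassCurve.b₈]
    ring
  rw [hΔ']
  exact div_ne_zero (mul_ne_zero (by norm_num) hΔ) (by norm_num)

/-- `Δ(f) ≠ 0` iff `4I(f)³ − J(f)² ≠ 0` (`27Δ = 4I³ − J²`). [cite: BhargavaShankarAnnals2015, §2 (Δ = (4I³ − J²)/27)] -/
theorem four_mul_I_pow_three_sub_ne_zero {f : BinaryQuartic K} (hΔ : f.disc ≠ 0) :
    4 * f.I ^ 3 - f.J ^ 2 ≠ 0 := by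
  rw [← twentySeven_mul_disc]
  exact mul_ne_zero (by norm_num) hΔ

/-- The covering map lands in the nonsingular points when `Δ(f) ≠ 0`. [cite: Cremona2001, Prop. 4.2] -/
theorem nonsingular_covering {f : BinaryQuartic K} (hΔ : f.disc ≠ 0) {x y z : K}
    (hz : z ^ 2 = f.eval x y) (hz0 : z ≠ 0) :
    (curveOfInvariants K f.I f.J).toAffine.Nonsingular (coveringX f x y z) (coveringY f x y z) := by
  haveI := isElliptic_curveOfInvariants_of_ne (four_mul_I_pow_three_sub_ne_zero hΔ)
  exact WeierstrassCurve.Affine.equation_iff_nonsingular.mp (equation_covering f hz hz0)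

/-- **The `2`-covering map** `C_f(K) ∖ {z = 0} → E_{I,J}(K)`, `(x,y,z) ↦ (g₄/(12z²), g₆/(8z³))`,
as a point of Mathlib's group `E_{I,J}(K)` (Cremona 2001, Prop. 4.2; the points with `z = 0`, i.e.
the roots of `f`, go to the origin and are not covered by this definition).
[cite: Cremona2001, Prop. 4.2] -/
def coveringPoint {f : BinaryQuartic K} (hΔ : f.disc ≠ 0) {x y z : K} (hz : z ^ 2 = f.eval x y)
    (hz0 : z ≠ 0) : (curveOfInvariants K f.I f.J).toAffine.Point :=
  .some _ _ (nonsingular_covering hΔ hz hz0)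

/-- Rescaling the representative `(x, y, z) ↦ (tx, ty, t²z)` of a point of `C_f` does not change
its image: `x`-coordinate. [folklore] -/
theorem coveringX_smul (f : BinaryQuartic K) {t : K} (ht : t ≠ 0) (x y z : K) :
    coveringX f (t * x) (t * y) (t ^ 2 * z) = coveringX f x y z := by
  simp only [coveringX, g4_eval_smul_smul]
  by_cases hz : z = 0
  · simp [hz]
  · field_simp

/-- Rescaling the representative of a point of `C_f` does not change its image: `y`-coordinate. [folklore] -/
theorem coveringY_smul (f : BinaryQuartic K) {t : K} (ht : t ≠ 0) (x y z : K) :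
    coveringY f (t * x) (t * y) (t ^ 2 * z) = coveringY f x y z := by
  simp only [coveringY, g6_smul_smul]
  by_cases hz : z = 0
  · simp [hz]
  · field_simp

/-- **Invariance of the covering map under the twisted action**, `x`-coordinate: if
`(X, Y) = (x,y)γ` and `z² = f(X,Y)`, then `(x, y, z/det γ)` lies on `C_{γ·f}`
(`sq_div_det_eq_eval_twist`) and has the same image in `E_{I,J}` as `(X, Y, z) ∈ C_f`.
[cite: Cremona2001, Prop. 4.2 (with §2: covariance of g₄)] -/
theorem coveringX_twist {γ : Matrix (Fin 2) (Fin 2) K} (hγ : γ.det ≠ 0) (f : BinaryQuartic K)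
    (x y z : K) :
    coveringX (twist γ f) x y (z / γ.det) =
      coveringX f (x * γ 0 0 + y * γ 1 0) (x * γ 0 1 + y * γ 1 1) z := by
  simp only [coveringX, g4_twist_eval hγ]
  by_cases hz : z = 0
  · simp [hz]
  · field_simp

/-- **Invariance of the covering map under the twisted action**, `y`-coordinate.
[cite: Cremona2001, Prop. 4.2 (with §2: covariance of g₆)] -/
theorem coveringY_twist {γ : Matrix (Fin 2) (Fin 2) K} (hγ : γ.det ≠ 0) (f : BinaryQuartic K)
    (x y z : K) :
    coveringY (twist γ f) x y (z / γ.det) =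
      coveringY f (x * γ 0 0 + y * γ 1 0) (x * γ 0 1 + y * γ 1 1) z := by
  simp only [coveringY, g6_twist hγ]
  by_cases hz : z = 0
  · simp [hz]
  · field_simp

omit [CharZero K] in
/-- The point `(x, y, z/det γ)` lies on `C_{γ·f}` when `z² = f((x,y)γ)`. [folklore] -/
theorem sq_div_det_eq_eval_twist {γ : Matrix (Fin 2) (Fin 2) K} (hγ : γ.det ≠ 0)
    (f : BinaryQuartic K) {x y z : K}
    (hz : z ^ 2 = f.eval (x * γ 0 0 + y * γ 1 0) (x * γ 0 1 + y * γ 1 1)) :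
    (z / γ.det) ^ 2 = (twist γ f).eval x y := by
  rw [eval_twist, ← hz]
  field_simp

/-- Special case used for normal forms: the image of the base point `(1, 0, 1)` of `C_{γ·f}` is the
image of `((1,0)γ, det γ) = (γ₀₀, γ₀₁, det γ)`. [folklore] -/
theorem coveringX_twist_one_zero {γ : Matrix (Fin 2) (Fin 2) K} (hγ : γ.det ≠ 0)
    (f : BinaryQuartic K) : coveringX (twist γ f) 1 0 1 = coveringX f (γ 0 0) (γ 0 1) γ.det := by
  have h := coveringX_twist hγ f 1 0 γ.det
  rw [div_self hγ] at h
  simpa using h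

/-- Special case used for normal forms, `y`-coordinate. [folklore] -/
theorem coveringY_twist_one_zero {γ : Matrix (Fin 2) (Fin 2) K} (hγ : γ.det ≠ 0)
    (f : BinaryQuartic K) : coveringY (twist γ f) 1 0 1 = coveringY f (γ 0 0) (γ 0 1) γ.det := by
  have h := coveringY_twist hγ f 1 0 γ.det
  rw [div_self hγ] at h
  simpa using h

/-! ## The normal forms `f_P` and `f_O` -/

omit [CharZero K] in
/-- **The quartic `f_P` attached to an affine point `P = (ξ, η)` of `E_{I,J}`**:
`f_P = x⁴ − (3ξ/2) x²y² + η xy³ + (I/12 − 3ξ²/16) y⁴`, the unique form `(1, 0, c, d, e)` with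
invariant `I` whose base point `(1,0,1)` maps to `P` under the covering map (an explicit
representative of `Q_E(P)` in Bhargava–Shankar's Lemma 5.10; the source refers to [CS] for an
explicit construction). [cite: BhargavaShankarAnnals2015, Lemma 5.10 (arXiv:1006.1002v2 numbering)] -/
def quarticOfPoint (I ξ η : K) : BinaryQuartic K :=
  ⟨1, 0, -(3 / 2) * ξ, η, I / 12 - 3 / 16 * ξ ^ 2⟩

omit [CharZero K] in
/-- **The trivial quartic `f_O = x³y − (I/3) xy³ − (J/27) y⁴ = y · (x³ − (I/3)xy² − (J/27)y³)`**
("`y` times the `2`-division cubic of `E_{I,J}`"): the representative of the identity class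
`Q_E(O)` in Lemma 5.10, i.e. of the quartics with invariants `(I, J)` having a `K`-rational linear
factor. This is the form `q_{I,J}` of Bhargava–Shankar's proof of Prop. 2.8 (treated over `ℝ`, as a
literal, in `BinaryQuarticRealOrbitsProofs.lean`: `I_qForm`, `J_qForm`, `eq_qForm_of_abc`).
[cite: BhargavaShankarAnnals2015, Lemma 5.10 and proof of Prop. 2.8 (q_{I,J}; arXiv:1006.1002v2 numbering)] -/
def trivialQuartic (I J : K) : BinaryQuartic K :=
  ⟨0, 1, 0, -I / 3, -J / 27⟩

omit [CharZero K] in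
/-- `f_P` is monic (definitional). [folklore] -/
@[simp] theorem quarticOfPoint_a (I ξ η : K) : (quarticOfPoint I ξ η).a = 1 := rfl
omit [CharZero K] in
/-- `f_P` has `b = 0` (definitional). [folklore] -/
@[simp] theorem quarticOfPoint_b (I ξ η : K) : (quarticOfPoint I ξ η).b = 0 := rfl
omit [CharZero K] in
/-- The coefficient `c = −3ξ/2` of `f_P` (definitional). [folklore] -/
@[simp] theorem quarticOfPoint_c (I ξ η : K) : (quarticOfPoint I ξ η).c = -(3 / 2) * ξ := rfl
omit [CharZero K] in
/-- The coefficient `d = η` of `f_P` (definitional). [folklore] -/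
@[simp] theorem quarticOfPoint_d (I ξ η : K) : (quarticOfPoint I ξ η).d = η := rfl
omit [CharZero K] in
/-- The coefficient `e = I/12 − 3ξ²/16` of `f_P` (definitional). [folklore] -/
@[simp] theorem quarticOfPoint_e (I ξ η : K) :
    (quarticOfPoint I ξ η).e = I / 12 - 3 / 16 * ξ ^ 2 := rfl

/-- `I(f_P) = I`. [cite: BhargavaShankarAnnals2015, Lemma 5.10 (arXiv:1006.1002v2 numbering)] -/
theorem I_quarticOfPoint (I ξ η : K) : (quarticOfPoint I ξ η).I = I := by
  simp only [BinaryQuartic.I, quarticOfPoint]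
  ring

/-- `J(f_P) = −27(η² − ξ³ + (I/3)ξ)`, so that `J(f_P) = J` iff `η² = ξ³ − (I/3)ξ − J/27`, i.e. iff
`P = (ξ, η) ∈ E_{I,J}`. [cite: BhargavaShankarAnnals2015, Lemma 5.10 (arXiv:1006.1002v2 numbering)] -/
theorem J_quarticOfPoint (I ξ η : K) :
    (quarticOfPoint I ξ η).J = -27 * (η ^ 2 - ξ ^ 3 + I / 3 * ξ) := by
  simp only [BinaryQuartic.J, quarticOfPoint]
  ring

/-- The affine equation of `E_{I,J}`, multiplied out. [cite: BhargavaShankarAnnals2015, §5 p. 31 (E_{I,J}; arXiv:1006.1002v2 numbering)] -/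
theorem curveOfInvariants_equation_iff (I J x y : K) :
    (curveOfInvariants K I J).toAffine.Equation x y ↔ y ^ 2 = x ^ 3 - I / 3 * x - J / 27 := by
  rw [WeierstrassCurve.Affine.equation_iff]
  simp only [curveOfInvariants]
  constructor <;> intro h <;> linear_combination h

/-- `P ∈ E_{I,J}` iff `f_P` has invariants `(I, J)` (given `I(f_P) = I`): the affine equation of
`E_{I,J}` at `(ξ, η)` is `J(f_P) = J`. [cite: BhargavaShankarAnnals2015, Lemma 5.10 (arXiv:1006.1002v2 numbering)] -/
theorem J_quarticOfPoint_eq_iff (I J ξ η : K) :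
    (quarticOfPoint I ξ η).J = J ↔ (curveOfInvariants K I J).toAffine.Equation ξ η := by
  rw [J_quarticOfPoint, curveOfInvariants_equation_iff]
  constructor
  · intro h; linear_combination -(1 / 27) * h
  · intro h; linear_combination -27 * h

omit [CharZero K] in
/-- `f_P` is `K`-soluble: `(1, 0, 1)` is a point of `C_{f_P}` (`f_P(1,0) = 1`). [cite: BhargavaShankarAnnals2015, Lemma 5.10 (arXiv:1006.1002v2 numbering)] -/
theorem isSoluble_quarticOfPoint (I ξ η : K) : (quarticOfPoint I ξ η).IsSoluble :=
  ⟨1, 0, 1, Or.inl one_ne_zero, by simp [eval, quarticOfPoint]⟩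

omit [CharZero K] in
/-- The base point: `f_P(1, 0) = 1 = 1²`. [folklore] -/
theorem eval_quarticOfPoint_one_zero (I ξ η : K) : (quarticOfPoint I ξ η).eval 1 0 = 1 := by
  simp [eval, quarticOfPoint]

/-- The base point `p₀ = (1,0,1)` of `C_{f_P}` maps to `P`: `x`-coordinate `ξ`. [cite: BhargavaShankarAnnals2015, Lemma 5.10 (arXiv:1006.1002v2 numbering)] -/
theorem coveringX_quarticOfPoint (I ξ η : K) : coveringX (quarticOfPoint I ξ η) 1 0 1 = ξ := by
  simp only [coveringX, g4_eval_one_zero, quarticOfPoint]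
  field_simp
  ring

/-- The base point `p₀ = (1,0,1)` of `C_{f_P}` maps to `P`: `y`-coordinate `η`. [cite: BhargavaShankarAnnals2015, Lemma 5.10 (arXiv:1006.1002v2 numbering)] -/
theorem coveringY_quarticOfPoint (I ξ η : K) : coveringY (quarticOfPoint I ξ η) 1 0 1 = η := by
  simp only [coveringY, g6_one_zero, quarticOfPoint]
  field_simp
  ring

/-- A monic form with `b = 0` is `f_P` for `P = (−2c/3, d)`, `I = I(f)`. [folklore] -/
theorem eq_quarticOfPoint_of_a_eq_one {f : BinaryQuartic K} (ha : f.a = 1) (hb : f.b = 0) :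
    f = quarticOfPoint f.I (-(2 / 3) * f.c) f.d := by
  ext
  · simp [ha]
  · simp [hb]
  · simp only [quarticOfPoint_c]; ring
  · simp
  · simp only [quarticOfPoint_e, BinaryQuartic.I, ha, hb]; ring

/-- For a monic form with `b = 0`, the base point `(1,0,1)` maps to `(−2c/3, d)`: `x`-coordinate. [folklore] -/
theorem coveringX_one_zero_one_of_a_eq_one {f : BinaryQuartic K} (ha : f.a = 1) (hb : f.b = 0) :
    coveringX f 1 0 1 = -(2 / 3) * f.c := by
  simp only [coveringX, g4_eval_one_zero, ha, hb]
  field_simp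
  ring

/-- For a monic form with `b = 0`, the base point `(1,0,1)` maps to `(−2c/3, d)`: `y`-coordinate. [folklore] -/
theorem coveringY_one_zero_one_of_a_eq_one {f : BinaryQuartic K} (ha : f.a = 1) (hb : f.b = 0) :
    coveringY f 1 0 1 = f.d := by
  simp only [coveringY, g6_one_zero, ha, hb]
  field_simp
  ring

/-- `I(f_O) = I`. [cite: BhargavaShankarAnnals2015, Lemma 5.10 (arXiv:1006.1002v2 numbering)] -/
theorem I_trivialQuartic (I J : K) : (trivialQuartic I J).I = I := by
  simp only [BinaryQuartic.I, trivialQuartic]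
  ring

/-- `J(f_O) = J`. [cite: BhargavaShankarAnnals2015, Lemma 5.10 (arXiv:1006.1002v2 numbering)] -/
theorem J_trivialQuartic (I J : K) : (trivialQuartic I J).J = J := by
  simp only [BinaryQuartic.J, trivialQuartic]
  ring

omit [CharZero K] in
/-- `f_O` is `K`-soluble: `(1, 0, 0)` is a point of `C_{f_O}` (`[1:0]` is a root of `f_O`). [cite: BhargavaShankarAnnals2015, Lemma 5.10 (arXiv:1006.1002v2 numbering)] -/
theorem isSoluble_trivialQuartic (I J : K) : (trivialQuartic I J).IsSoluble :=
  ⟨1, 0, 0, Or.inl one_ne_zero, by simp [eval, trivialQuartic]⟩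

omit [CharZero K] in
/-- `f_O = y · (x³ − (I/3) x y² − (J/27) y³)`: the value of `f_O` at `(x, 1)` is the `2`-division
cubic of `E_{I,J}` at `x`, so the points `(x, 1, z)` of `C_{f_O}` are exactly the affine points
`(x, z)` of `E_{I,J}`. [cite: BhargavaShankarAnnals2015, Lemma 5.10 (arXiv:1006.1002v2 numbering)] -/
theorem eval_trivialQuartic_one (I J x : K) :
    (trivialQuartic I J).eval x 1 = x ^ 3 - I / 3 * x - J / 27 := by
  simp only [eval, trivialQuartic]
  ring

/-- A form `(0, 1, 0, d, e)` with invariants `(I, J)` is `f_O`. [folklore] -/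
theorem eq_trivialQuartic_of_abc {f : BinaryQuartic K} (ha : f.a = 0) (hb : f.b = 1) (hc : f.c = 0) :
    f = trivialQuartic f.I f.J := by
  ext
  · simp [trivialQuartic, ha]
  · simp [trivialQuartic, hb]
  · simp [trivialQuartic, hc]
  · simp only [trivialQuartic, BinaryQuartic.I, ha, hb, hc]; ring
  · simp only [trivialQuartic, BinaryQuartic.J, ha, hb, hc]; ring

omit [CharZero K] in
/-- If `a = b = 0` then `Δ = 0` (`y²` divides the form; local copy of a lemma of
`BinaryQuarticRealOrbitsProofs.lean`, to keep the import graph small). [folklore] -/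
private theorem disc_eq_zero_of_ab_eq_zero {R : Type*} [CommRing R] {f : BinaryQuartic R}
    (ha : f.a = 0) (hb : f.b = 0) : f.disc = 0 := by
  simp [disc, ha, hb]

/-! ## Normal forms -/

omit [CharZero K] in
/-- A matrix with prescribed first row `(x, y) ≠ (0, 0)` and prescribed determinant `z`. [folklore] -/
theorem exists_matrix_row_det (x y z : K) (hxy : x ≠ 0 ∨ y ≠ 0) :
    ∃ γ : Matrix (Fin 2) (Fin 2) K, γ 0 0 = x ∧ γ 0 1 = y ∧ γ.det = z := by
  by_cases hx : x = 0
  · have hy : y ≠ 0 := hxy.resolve_left (not_not.mpr hx)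
    refine ⟨!![x, y; -z / y, 0], by simp, by simp, ?_⟩
    rw [Matrix.det_fin_two_of, hx]
    field_simp
    ring
  · refine ⟨!![x, y; 0, z / x], by simp, by simp, ?_⟩
    rw [Matrix.det_fin_two_of]
    field_simp
    ring

/-- **Normal form of a pointed soluble quartic** (the existence half of Bhargava–Shankar's
Lemma 5.10, made explicit): if `z² = f(x,y)` with `z ≠ 0`, then `f` is `PGL₂(K)`-equivalent (twisted
action) to `f_P`, where `P = (g₄(x,y)/(12z²), g₆(x,y)/(8z³))` is the image of `(x, y, z)` under
the `2`-covering map. Proof: a `γ₁` with first row `(x, y)` and `det γ₁ = z` makes `γ₁ · f` monic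
(Cremona 2001, Prop. 4.1), a shear `x ↦ x − (b/4)y` kills `b`, and a monic form with `b = 0` is
`f_P` with `P` the image of its base point, which is the image of `(x, y, z)` by invariance of the
covering map. [cite: BhargavaShankarAnnals2015, Lemma 5.10 (arXiv:1006.1002v2 numbering)] -/
theorem exists_twist_eq_quarticOfPoint (f : BinaryQuartic K) {x y z : K} (hxy : x ≠ 0 ∨ y ≠ 0)
    (hz : z ^ 2 = f.eval x y) (hz0 : z ≠ 0) :
    ∃ γ : Matrix (Fin 2) (Fin 2) K, γ.det ≠ 0 ∧
      twist γ f = quarticOfPoint f.I (coveringX f x y z) (coveringY f x y z) := by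
  obtain ⟨γ₁, h00, h01, hdet⟩ := exists_matrix_row_det x y z hxy
  have hγ₁ : γ₁.det ≠ 0 := hdet ▸ hz0
  set f₁ := twist γ₁ f with hf₁
  have ha₁ : f₁.a = 1 := by
    rw [hf₁, twist_a_eq, h00, h01, hdet, ← hz, inv_mul_cancel₀ (pow_ne_zero 2 hz0)]
  have hX₁ : coveringX f₁ 1 0 1 = coveringX f x y z := by
    rw [hf₁, coveringX_twist_one_zero hγ₁, h00, h01, hdet]
  have hY₁ : coveringY f₁ 1 0 1 = coveringY f x y z := by
    rw [hf₁, coveringY_twist_one_zero hγ₁, h00, h01, hdet]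
  set t := -f₁.b / 4 with ht
  set γ₂ : Matrix (Fin 2) (Fin 2) K := !![1, 0; t, 1] with hγ₂
  have hdet₂ : γ₂.det = 1 := by simp [hγ₂, Matrix.det_fin_two]
  have hγ₂' : γ₂.det ≠ 0 := by rw [hdet₂]; exact one_ne_zero
  set f₂ := twist γ₂ f₁ with hf₂
  have hf₂' : f₂ = ⟨f₁.a, 4 * f₁.a * t + f₁.b, 6 * f₁.a * t ^ 2 + 3 * f₁.b * t + f₁.c,
      4 * f₁.a * t ^ 3 + 3 * f₁.b * t ^ 2 + 2 * f₁.c * t + f₁.d,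
      f₁.a * t ^ 4 + f₁.b * t ^ 3 + f₁.c * t ^ 2 + f₁.d * t + f₁.e⟩ := by
    rw [hf₂, hγ₂, twist_lowerShear]
  have ha₂ : f₂.a = 1 := by rw [hf₂']; exact ha₁
  have hb₂ : f₂.b = 0 := by
    rw [hf₂']
    show 4 * f₁.a * t + f₁.b = 0
    rw [ha₁, ht]; ring
  have h10 : (1 : K) * γ₂ 0 0 + 0 * γ₂ 1 0 = 1 ∧ (1 : K) * γ₂ 0 1 + 0 * γ₂ 1 1 = 0 := by
    simp [hγ₂]
  have hX₂ : coveringX f₂ 1 0 1 = coveringX f x y z := by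
    rw [hf₂, coveringX_twist_one_zero hγ₂', hdet₂, ← hX₁]
    simp [hγ₂]
  have hY₂ : coveringY f₂ 1 0 1 = coveringY f x y z := by
    rw [hf₂, coveringY_twist_one_zero hγ₂', hdet₂, ← hY₁]
    simp [hγ₂]
  have hI₂ : f₂.I = f.I := by rw [hf₂, I_twist hγ₂', hf₁, I_twist hγ₁]
  refine ⟨γ₂ * γ₁, by rw [Matrix.det_mul]; exact mul_ne_zero hγ₂' hγ₁, ?_⟩
  rw [twist_mul, ← hf₁, ← hf₂, eq_quarticOfPoint_of_a_eq_one ha₂ hb₂, hI₂,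
    ← coveringX_one_zero_one_of_a_eq_one ha₂ hb₂, ← coveringY_one_zero_one_of_a_eq_one ha₂ hb₂,
    hX₂, hY₂]

/-- **Normal form of a quartic with a rational root** (the identity class in Bhargava–Shankar's
Lemma 5.10, made explicit): if `f(x,y) = 0` with `(x,y) ≠ (0,0)` and `Δ(f) ≠ 0`, then `f` is
`PGL₂(K)`-equivalent to `f_O = x³y − (I/3)xy³ − (J/27)y⁴`. Proof: move the root to `[1:0]`
(`a = 0`, and then `b ≠ 0` as `Δ ≠ 0`), rescale `y` to get `b = 1`, shear `x ↦ x − (c/3)y` to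
kill `c`; the invariants then force `(d, e) = (−I/3, −J/27)`. [cite: BhargavaShankarAnnals2015, Lemma 5.10 (arXiv:1006.1002v2 numbering)] -/
theorem exists_twist_eq_trivialQuartic {f : BinaryQuartic K} (hΔ : f.disc ≠ 0) {x y : K}
    (hxy : x ≠ 0 ∨ y ≠ 0) (h0 : f.eval x y = 0) :
    ∃ γ : Matrix (Fin 2) (Fin 2) K, γ.det ≠ 0 ∧ twist γ f = trivialQuartic f.I f.J := by
  -- move the root to `[1:0]`
  obtain ⟨γ₁, h00, h01, hdet⟩ := exists_matrix_row_det x y 1 hxy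
  have hγ₁ : γ₁.det ≠ 0 := by rw [hdet]; exact one_ne_zero
  set f₁ := twist γ₁ f with hf₁
  have ha₁ : f₁.a = 0 := by rw [hf₁, twist_a_eq, h00, h01, h0, mul_zero]
  have hΔ₁ : f₁.disc ≠ 0 := by rwa [hf₁, disc_twist three_ne_zero hγ₁]
  have hb₁ : f₁.b ≠ 0 := fun hb ↦ hΔ₁ (disc_eq_zero_of_ab_eq_zero ha₁ hb)
  -- rescale to `b = 1`
  set γ₃ : Matrix (Fin 2) (Fin 2) K := !![1, 0; 0, f₁.b] with hγ₃
  have hdet₃ : γ₃.det = f₁.b := by simp [hγ₃, Matrix.det_fin_two]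
  have hγ₃' : γ₃.det ≠ 0 := by rwa [hdet₃]
  set f₃ := twist γ₃ f₁ with hf₃
  have hf₃' : f₃ = ⟨0, 1, f₁.c, f₁.d * f₁.b, f₁.e * f₁.b ^ 2⟩ := by
    rw [hf₃, twist, hdet₃]
    ext <;> simp [hγ₃, subst, ha₁] <;> field_simp
  -- kill `c`
  set t := -f₁.c / 3 with ht
  set γ₄ : Matrix (Fin 2) (Fin 2) K := !![1, 0; t, 1] with hγ₄
  have hdet₄ : γ₄.det = 1 := by simp [hγ₄, Matrix.det_fin_two]
  have hγ₄' : γ₄.det ≠ 0 := by rw [hdet₄]; exact one_ne_zero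
  set f₄ := twist γ₄ f₃ with hf₄
  have hf₄' : f₄ = ⟨f₃.a, 4 * f₃.a * t + f₃.b, 6 * f₃.a * t ^ 2 + 3 * f₃.b * t + f₃.c,
      4 * f₃.a * t ^ 3 + 3 * f₃.b * t ^ 2 + 2 * f₃.c * t + f₃.d,
      f₃.a * t ^ 4 + f₃.b * t ^ 3 + f₃.c * t ^ 2 + f₃.d * t + f₃.e⟩ := by
    rw [hf₄, hγ₄, twist_lowerShear]
  have ha₄ : f₄.a = 0 := by rw [hf₄', hf₃']
  have hb₄ : f₄.b = 1 := by rw [hf₄', hf₃']; ring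
  have hc₄ : f₄.c = 0 := by
    rw [hf₄', hf₃']
    show 6 * 0 * t ^ 2 + 3 * 1 * t + f₁.c = 0
    rw [ht]; ring
  have hI₄ : f₄.I = f.I := by
    rw [hf₄, I_twist hγ₄', hf₃, I_twist hγ₃', hf₁, I_twist hγ₁]
  have hJ₄ : f₄.J = f.J := by
    rw [hf₄, J_twist hγ₄', hf₃, J_twist hγ₃', hf₁, J_twist hγ₁]
  refine ⟨γ₄ * γ₃ * γ₁, ?_, ?_⟩
  · rw [Matrix.det_mul, Matrix.det_mul]; exact mul_ne_zero (mul_ne_zero hγ₄' hγ₃') hγ₁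
  · rw [twist_mul, twist_mul, ← hf₁, ← hf₃, ← hf₄, eq_trivialQuartic_of_abc ha₄ hb₄ hc₄, hI₄, hJ₄]

/-- **Bhargava–Shankar, Lemma 5.10 — the image of `Q_E` contains every `K`-soluble class.** Over a
field of characteristic `0`, a `K`-soluble binary quartic form `f` with `Δ(f) ≠ 0` and invariants
`(I, J)` is `PGL₂(K)`-equivalent either to the trivial quartic `f_O` or to `f_P` for some
`K`-rational point `P = (ξ, η)` of `E_{I,J} : y² = x³ − (I/3)x − J/27` (and conversely `f_O`,
`f_P` are `K`-soluble with invariants `(I, J)`: `isSoluble_trivialQuartic`,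
`isSoluble_quarticOfPoint`, `I_trivialQuartic`, `J_trivialQuartic`, `I_quarticOfPoint`,
`J_quarticOfPoint_eq_iff`). [cite: BhargavaShankarAnnals2015, Lemma 5.10 (arXiv:1006.1002v2 numbering)] -/
theorem pgl2Equiv_normalForm {I J : K} {f : BinaryQuartic K} (hI : f.I = I) (hJ : f.J = J)
    (hΔ : f.disc ≠ 0) (hsol : f.IsSoluble) :
    PGL2Equiv f (trivialQuartic I J) ∨
      ∃ ξ η : K, (curveOfInvariants K I J).toAffine.Nonsingular ξ η ∧
        PGL2Equiv f (quarticOfPoint I ξ η) := by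
  obtain ⟨x, y, z, hxy, hz⟩ := hsol
  by_cases hz0 : z = 0
  · left
    have h0 : f.eval x y = 0 := by rw [← hz, hz0]; ring
    obtain ⟨γ, hγ, hγf⟩ := exists_twist_eq_trivialQuartic hΔ hxy h0
    exact ⟨γ, hγ, by rw [← hI, ← hJ, ← hγf, twist]⟩
  · right
    obtain ⟨γ, hγ, hγf⟩ := exists_twist_eq_quarticOfPoint f hxy hz hz0
    refine ⟨coveringX f x y z, coveringY f x y z, ?_, γ, hγ, by rw [← hI, ← hγf, twist]⟩
    rw [← hI, ← hJ]
    exact nonsingular_covering hΔ hz hz0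

/-- The same, packaged with the covering map: a pointed soluble quartic `(f; x, y, z)`, `z ≠ 0`, is
equivalent to `f_P` for the point `P = (g₄(x,y)/(12z²), g₆(x,y)/(8z³))` of `E_{I,J}(K)`. [cite: BhargavaShankarAnnals2015, Lemma 5.10 (arXiv:1006.1002v2 numbering)] -/
theorem pgl2Equiv_quarticOfPoint_covering (f : BinaryQuartic K) {x y z : K} (hxy : x ≠ 0 ∨ y ≠ 0)
    (hz : z ^ 2 = f.eval x y) (hz0 : z ≠ 0) :
    PGL2Equiv f (quarticOfPoint f.I (coveringX f x y z) (coveringY f x y z)) := by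
  obtain ⟨γ, hγ, hγf⟩ := exists_twist_eq_quarticOfPoint f hxy hz hz0
  exact ⟨γ, hγ, by rw [← hγf, twist]⟩

end BinaryQuartic

end Literature.NumberTheory.EllipticCurves

end
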